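import Literature.Barriers.CriticalPhenomena.LaceExpansionXSpaceTwoLongLinesJunctions
import Literature.Barriers.CriticalPhenomena.LaceExpansionXSpaceLongLineInsertion
import HarnessLib

/-!
# Special junctions of Hara's two-long-lines estimate (§3.5) at `p_c`: adjacent erasures (a lone
# rung between the two lines), the lone star block `B₂⁽²⁾`, and the three overlapping
# configurations of the star — PROVED

Barrier catalogue `Literature/Barriers/CriticalPhenomena/` (D-0021), infrastructure for the
conditional reduction of `Hara2008_twoLongLinesDiagramBoundPc` (`LaceExpansionXSpaceLemma15Diagrams.lean`,
Hara 2008, §3.5), continuing `LaceExpansionXSpaceTwoLongLinesJunctions.lean`.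

When the two erased lines of a term of the Hara–Slade diagram are far apart, the middle factor
between them closes under the Cauchy–Schwarz bound of the previous file. When they are adjacent,
the middle factor is too short to close and is instead bounded POINTWISE by a small closed diagram
(Hara's Case 1: "`G_{x,N}²` times convergent diagrams, which are bounded by some powers of
triangles"), and the chain by the degenerate three-factor estimate `chain_sup_le`. PROVED here:

* `tForm_comm` (`f ⋆ g ⋆ τ = g ⋆ f ⋆ τ`), the convolution `convT g = g ⋆ τ` and
  `wForm f (convT g) = tForm f g`;
* **a lone rung between the two lines** (`tsum_line_rho_line_le`, `chain_rungOnly_le`): entry line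
  into one coordinate of a pair, exit line out of the OTHER coordinate, the pair tied by a rung:
  `≤ c_F c_G T(f,g)` times the two masses;
* **the lone star block** (`tsum_line_kB2two_line_true_le`, `…_false_le`, `chain_loneB2two_le`):
  entry and exit on the SAME coordinate of the pairs around a `B₂⁽²⁾`: `≤ c_F c_G Δ(0) T(f,g)`;
* **the three overlaps of the star with an erased neighbour** (`conflictA_le`: `P_{τ,1} · S · B₁ ≤ Δ̃ S̄`;
  `conflictB_le`: `B₁ · S · P_{1,τ̃} ≤ 2d Δ̃ S̄`; `conflictC_le`: `B₁ S B₁ S B₁ ≤ 2d Δ̃² Δ̄ S̄`, where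
  `S = kB2twoEr`), each a tree of triangles and one square after summing the vertex of degree two;
* small identities moving rungs and scalars of the start/end vectors into the chain.

## References

* T. Hara, Ann. Probab. 36 (2008) 530–593 (arXiv:math-ph/0504021): §3.5 (Case 1: "bounded by
  some powers of triangles (and bubbles)"; Case 2; Fig. 4 (a-1)–(a-2), Fig. 5).
* M. Heydenreich, R. van der Hofstad, *Progress in High-Dimensional Percolation and Random
  Graphs*, Springer 2017: (7.2.1)–(7.2.2), (7.4.4).
-/

noncomputable section

open scoped ENNReal

namespace Literature.Barriers.CriticalPhenomena

open _root_.MeasureTheory Literature.Probability.LatticeModels Literature.Probability.Percolation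

variable {d : ℕ}

/-! ### The `T`-form is symmetric; the convolution with `τ` -/

/-- `T(f, g) = T(g, f)` (`f ⋆ g ⋆ τ = g ⋆ f ⋆ τ`). [folklore] -/
theorem tForm_comm (f g : Site d → ℝ≥0∞) : tForm d f g = tForm d g f := by
  refine iSup_congr fun a => ?_
  rw [ENNReal.tsum_prod', ENNReal.tsum_prod']
  calc ∑' x : Site d, ∑' y : Site d, f x * g (y - x) * tauPcE d (a - y)
      = ∑' y : Site d, ∑' x : Site d, f x * g (y - x) * tauPcE d (a - y) := ENNReal.tsum_comm
    _ = ∑' y : Site d, ∑' x : Site d, g x * f (y - x) * tauPcE d (a - y) := by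
        refine tsum_congr fun y => ?_
        rw [tsum_reflect_shift _ y]
        refine tsum_congr fun x => ?_
        rw [show y - (y - x) = x by abel]
        ring
    _ = ∑' x : Site d, ∑' y : Site d, g x * f (y - x) * tauPcE d (a - y) := ENNReal.tsum_comm

/-- `convT g (z) := Σ_v g(v) τ(z - v) = (g ⋆ τ)(z)`. [folklore] -/
def convT (d : ℕ) (g : Site d → ℝ≥0∞) (z : Site d) : ℝ≥0∞ := ∑' v : Site d, g v * tauPcE d (z - v)

/-- `convT g` is even when `g` is. [folklore] -/
theorem convT_neg {g : Site d → ℝ≥0∞} (hg : ∀ v, g (-v) = g v) (z : Site d) : convT d g (-z) = convT d g z := by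
  rw [convT, convT, ← (Equiv.neg (Site d)).tsum_eq (fun v => g v * tauPcE d (-z - v))]
  refine tsum_congr fun v => ?_
  simp only [Equiv.neg_apply, hg]
  rw [show -z - -v = -(z - v) by abel, tauPcE_neg]

/-- `Σ_v τ(c - v) g(v - b) = convT g (c - b)`. [folklore] -/
theorem tsum_tau_mul_eq_convT (g : Site d → ℝ≥0∞) (c b : Site d) :
    ∑' v : Site d, tauPcE d (c - v) * g (v - b) = convT d g (c - b) := by
  rw [convT, tsum_shift _ b]
  refine tsum_congr fun v => ?_
  rw [add_sub_cancel_right, show c - (v + b) = c - b - v by abel, mul_comm]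

/-- `Σ_t g(t - b) τ(t - c) = convT g (c - b)`. [folklore] -/
theorem tsum_mul_tau_eq_convT (g : Site d → ℝ≥0∞) (b c : Site d) :
    ∑' t : Site d, g (t - b) * tauPcE d (t - c) = convT d g (c - b) := by
  rw [← tsum_tau_mul_eq_convT g c b]
  exact tsum_congr fun t => by rw [tauPcE_sub_comm, mul_comm]

/-- **`W(f, g ⋆ τ) = T(f, g)`.** [cite: Hara2008, §1.1] -/
theorem wForm_convT_eq_tForm (f g : Site d → ℝ≥0∞) : wForm f (convT d g) = tForm d f g := by
  refine iSup_congr fun a => ?_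
  rw [ENNReal.tsum_prod']
  refine tsum_congr fun y => ?_
  rw [convT, ← ENNReal.tsum_mul_left, tsum_shift_sub _ y]
  refine tsum_congr fun v => ?_
  dsimp only
  rw [show a - y - (v - y) = a - v by abel]
  ring

/-- `Σ_y f(y - a) h(y - c) ≤ W(f, h)` for `h` even. [folklore] -/
theorem tsum_shift_le_wForm (f : Site d → ℝ≥0∞) {h : Site d → ℝ≥0∞} (hh : ∀ v, h (-v) = h v) (a c : Site d) :
    ∑' y : Site d, f (y - a) * h (y - c) ≤ wForm f h := by
  calc ∑' y : Site d, f (y - a) * h (y - c) = ∑' y : Site d, f y * h ((c - a) - y) := by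
        rw [tsum_shift _ a]
        refine tsum_congr fun y => ?_
        rw [add_sub_cancel_right, ← hh (y + a - c), show -(y + a - c) = c - a - y by abel]
    _ ≤ wForm f h := tsum_le_wForm f h (c - a)

/-! ### A lone rung between the two erased lines -/

/-- **Line – rung – line**: `Σ_P f(P_{e₁} - a) ρ(P) g(P_{e₂} - b) ≤ T(f, g)` when the two lines use
DIFFERENT coordinates of the pair (`e₁ ≠ e₂`; `f, g` even) — an open triangle.
[cite: Hara2008, §3.5 (Case 1, Fig. 4 (a-2): "bounded by some powers of triangles")] -/
theorem tsum_line_rho_line_le (e1 e2 : Bool) (he : e1 ≠ e2) {f g : Site d → ℝ≥0∞}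
    (hf : ∀ v, f (-v) = f v) (hg : ∀ v, g (-v) = g v) (a b : Site d) :
    ∑' P : Site d × Site d, f (crd e1 P - a) * rho d P * g (crd e2 P - b) ≤ tForm d f g := by
  cases e1 <;> cases e2
  · exact absurd rfl he
  · -- entry on coordinate 2, exit from coordinate 1
    simp only [crd_false, crd_true, rho_apply]
    rw [tForm_comm]
    calc ∑' P : Site d × Site d, f (P.2 - a) * tauPcE d (P.2 - P.1) * g (P.1 - b)
        = ∑' P : Site d × Site d, g (P.1 - b) * tauPcE d (P.2 - P.1) * f (a - P.2) := by
          refine tsum_congr fun P => ?_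
          rw [← hf (P.2 - a), neg_sub]
          ring
      _ = ∑' P : Site d × Site d, g P.1 * tauPcE d (P.2 - P.1) * f (a - b - P.2) := tsum_series3 _ _ _ b a
      _ = ∑' P : Site d × Site d, g P.1 * f (P.2 - P.1) * tauPcE d (a - b - P.2) :=
          tsum_swap23 g f (tauPcE d) (a - b)
      _ ≤ tForm d g f := tsum_le_tForm g f (a - b)
  · -- entry on coordinate 1, exit from coordinate 2
    simp only [crd_false, crd_true, rho_apply]
    calc ∑' P : Site d × Site d, f (P.1 - a) * tauPcE d (P.2 - P.1) * g (P.2 - b)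
        = ∑' P : Site d × Site d, f (P.1 - a) * tauPcE d (P.2 - P.1) * g (b - P.2) := by
          refine tsum_congr fun P => ?_
          rw [← hg (P.2 - b), neg_sub]
      _ = ∑' P : Site d × Site d, f P.1 * tauPcE d (P.2 - P.1) * g (b - a - P.2) := tsum_series3 _ _ _ a b
      _ = ∑' P : Site d × Site d, f P.1 * g (P.2 - P.1) * tauPcE d (b - a - P.2) :=
          tsum_swap23 f g (tauPcE d) (b - a)
      _ ≤ tForm d f g := tsum_le_tForm f g (b - a)
  · exact absurd rfl he

/-- **Adjacent erasures** (nothing but a rung between the entry line and the exit line): for the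
chain `v L X Y R e` with `X(p,P) ≤ c_F f(P_{e₁} - πp) ρ₁(P)`, `Y(P,q) ≤ ρ₂(P) c_G g(P_{e₂} - π'q)`,
`ρ₁ρ₂ ≤ ρ` and `e₁ ≠ e₂`: `Σ chain ≤ ‖vL‖₁ (c_F c_G T(f,g)) ‖Re‖₁`.
[cite: Hara2008, §3.5 (Case 1, Fig. 4 (a-2))] -/
theorem chain_rungOnly_le (v e : Site d × Site d → ℝ≥0∞)
    (Lpre Rpost : List (Site d × Site d → Site d × Site d → ℝ≥0∞))
    (X Y : Site d × Site d → Site d × Site d → ℝ≥0∞) (e1 e2 : Bool) (he : e1 ≠ e2)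
    {cF cG : ℝ≥0∞} {f g : Site d → ℝ≥0∞} {πF πG : Site d × Site d → Site d} {ρ₁ ρ₂ : Site d × Site d → ℝ≥0∞}
    (hX : ∀ p P, X p P ≤ cF * f (crd e1 P - πF p) * ρ₁ P)
    (hY : ∀ Q q, Y Q q ≤ ρ₂ Q * (cG * g (crd e2 Q - πG q)))
    (hρ : ∀ P, ρ₁ P * ρ₂ P ≤ rho d P) (hf : ∀ v, f (-v) = f v) (hg : ∀ v, g (-v) = g v)
    {M₁ M₂ T : ℝ≥0∞} (h₁ : ∑' p, pkChainL v Lpre p ≤ M₁) (h₂ : ∑' q, pkChainR Rpost e q ≤ M₂)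
    (hT : tForm d f g ≤ T) :
    ∑' s, pkChainL v (Lpre ++ X :: Y :: Rpost) s * e s ≤ M₁ * (cF * cG * T) * M₂ := by
  rw [pkChainL_append_cons_cons]
  refine chain_sup_le v e Lpre Rpost (pkMul X Y) (fun p q => ?_) h₁ h₂
  calc pkMul X Y p q = ∑' P, X p P * Y P q := rfl
    _ ≤ ∑' P, (cF * f (crd e1 P - πF p) * ρ₁ P) * (ρ₂ P * (cG * g (crd e2 P - πG q))) :=
        ENNReal.tsum_le_tsum fun P => mul_le_mul' (hX p P) (hY P q)
    _ ≤ ∑' P, cF * cG * (f (crd e1 P - πF p) * rho d P * g (crd e2 P - πG q)) := by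
        refine ENNReal.tsum_le_tsum fun P => ?_
        calc cF * f (crd e1 P - πF p) * ρ₁ P * (ρ₂ P * (cG * g (crd e2 P - πG q)))
            = cF * cG * (f (crd e1 P - πF p) * (ρ₁ P * ρ₂ P) * g (crd e2 P - πG q)) := by ring
          _ ≤ cF * cG * (f (crd e1 P - πF p) * rho d P * g (crd e2 P - πG q)) :=
              mul_le_mul' le_rfl (mul_le_mul' (mul_le_mul' le_rfl (hρ P)) le_rfl)
    _ = cF * cG * ∑' P, f (crd e1 P - πF p) * rho d P * g (crd e2 P - πG q) := ENNReal.tsum_mul_left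
    _ ≤ cF * cG * T := mul_le_mul' le_rfl ((tsum_line_rho_line_le e1 e2 he hf hg _ _).trans hT)

/-! ### The lone star block between two lines on the same coordinate -/

/-- The star block after its `δ` is resolved: `Σ_Q B₂⁽²⁾(P, Q) h(Q) = Σ_t [Σ_a τ(a - P.2) τ(P.1 - a) τ(t - a) τ(t - P.1)] h(P.2, t)`.
[cite: HeydenreichVanDerHofstad2017, (7.4.4)] -/
theorem tsum_kB2two_mul (P : Site d × Site d) (h : Site d × Site d → ℝ≥0∞) :
    ∑' Q, kB2two d P Q * h Q = ∑' t : Site d, (∑' a : Site d,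
      tauPcE d (a - P.2) * tauPcE d (P.1 - a) * tauPcE d (t - a) * tauPcE d (t - P.1)) * h (P.2, t) :=
  tsum_kB2two_eq P h

/-- **Lone star block, lines on coordinate 1**: `Σ_{P,Q} f(P.1 - a) B₂⁽²⁾(P,Q) g(Q.1 - b) ≤ Δ(0) T(f,g)`
(`g` even): summing the far vertex `t` of the star closes a bubble, which with the leg `τ(u - a')` is
the weight `g⋆` of total mass `Δ(0)`; the rest is the open triangle `T(f, g)`.
[cite: Hara2008, §3.5 (Case 2, Fig. 5 (d-3): "triangles, squares")] -/
theorem tsum_line_kB2two_line_true_le (f : Site d → ℝ≥0∞) {g : Site d → ℝ≥0∞} (hg : ∀ v, g (-v) = g v)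
    (a b : Site d) :
    ∑' P, ∑' Q, f (P.1 - a) * kB2two d P Q * g (Q.1 - b) ≤ percTri d 0 * tForm d f g := by
  have hcT : ∀ v, convT d g (-v) = convT d g v := convT_neg hg
  calc ∑' P, ∑' Q, f (P.1 - a) * kB2two d P Q * g (Q.1 - b)
      = ∑' P : Site d × Site d, f (P.1 - a) * (g (P.2 - b) *
          ∑' a' : Site d, tauPcE d (a' - P.2) * gStar d (P.1 - a')) := by
        refine tsum_congr fun P => ?_
        have h1 : ∑' Q, f (P.1 - a) * kB2two d P Q * g (Q.1 - b) =
            f (P.1 - a) * ∑' Q, kB2two d P Q * g (Q.1 - b) := by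
          rw [← ENNReal.tsum_mul_left]; exact tsum_congr fun Q => mul_assoc _ _ _
        rw [h1, tsum_kB2two_mul]
        congr 1
        -- `Σ_t [Σ_{a'} τ(a'-v) τ(u-a') τ(t-a') τ(t-u)] g(v - b) = g(v-b) Σ_{a'} τ(a'-v) g⋆(u-a')`
        calc ∑' t : Site d, (∑' a' : Site d, tauPcE d (a' - P.2) * tauPcE d (P.1 - a') *
              tauPcE d (t - a') * tauPcE d (t - P.1)) * g (P.2 - b)
            = g (P.2 - b) * ∑' a' : Site d, ∑' t : Site d, tauPcE d (a' - P.2) * tauPcE d (P.1 - a') *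
                (tauPcE d (t - a') * tauPcE d (P.1 - t)) := by
              rw [ENNReal.tsum_mul_right, mul_comm, ENNReal.tsum_comm]
              congr 1
              refine tsum_congr fun a' => tsum_congr fun t => ?_
              rw [tauPcE_sub_comm t P.1]
              ring
          _ = g (P.2 - b) * ∑' a' : Site d, tauPcE d (a' - P.2) * gStar d (P.1 - a') := by
              congr 1
              refine tsum_congr fun a' => ?_
              rw [ENNReal.tsum_mul_left, tsum_tau2_eq_percBubble, gStar, tauPcE_sub_comm P.1 a']
              ring
    -- reorganise as `Σ_u f(u-a) Σ_{a'} g⋆(u-a') [Σ_v τ(a'-v) g(v-b)]`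
    _ = ∑' u : Site d, f (u - a) * ∑' a' : Site d, gStar d (u - a') * convT d g (a' - b) := by
        rw [ENNReal.tsum_prod']
        refine tsum_congr fun u => ?_
        rw [← ENNReal.tsum_mul_left]
        calc ∑' v : Site d, f (u - a) * (g (v - b) * ∑' a' : Site d, tauPcE d (a' - v) * gStar d (u - a'))
            = ∑' v : Site d, ∑' a' : Site d, f (u - a) * (gStar d (u - a') * (tauPcE d (a' - v) * g (v - b))) := by
              refine tsum_congr fun v => ?_
              rw [← ENNReal.tsum_mul_left, ← ENNReal.tsum_mul_left]
              exact tsum_congr fun a' => by ring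
          _ = ∑' a' : Site d, ∑' v : Site d, f (u - a) * (gStar d (u - a') * (tauPcE d (a' - v) * g (v - b))) :=
              ENNReal.tsum_comm
          _ = ∑' a' : Site d, f (u - a) * (gStar d (u - a') * convT d g (a' - b)) := by
              refine tsum_congr fun a' => ?_
              rw [ENNReal.tsum_mul_left, ENNReal.tsum_mul_left, tsum_tau_mul_eq_convT]
    -- `a' = u - w`
    _ = ∑' u : Site d, f (u - a) * ∑' w : Site d, gStar d w * convT d g (u - w - b) := by
        refine tsum_congr fun u => ?_
        congr 1
        rw [tsum_reflect_shift _ u]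
        exact tsum_congr fun w => by rw [show u - (u - w) = w by abel]
    _ = ∑' w : Site d, gStar d w * ∑' u : Site d, f (u - a) * convT d g (u - (w + b)) := by
        calc ∑' u : Site d, f (u - a) * ∑' w : Site d, gStar d w * convT d g (u - w - b)
            = ∑' u : Site d, ∑' w : Site d, gStar d w * (f (u - a) * convT d g (u - (w + b))) := by
              refine tsum_congr fun u => ?_
              rw [← ENNReal.tsum_mul_left]
              exact tsum_congr fun w => by rw [show u - w - b = u - (w + b) by abel]; ring
          _ = ∑' w : Site d, ∑' u : Site d, gStar d w * (f (u - a) * convT d g (u - (w + b))) := ENNReal.tsum_comm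
          _ = _ := tsum_congr fun w => ENNReal.tsum_mul_left
    _ ≤ ∑' w : Site d, gStar d w * tForm d f g := by
        refine ENNReal.tsum_le_tsum fun w => mul_le_mul' le_rfl ?_
        rw [← wForm_convT_eq_tForm]
        exact tsum_shift_le_wForm f hcT a (w + b)
    _ = percTri d 0 * tForm d f g := by rw [ENNReal.tsum_mul_right, tsum_gStar]

/-- **Lone star block, lines on coordinate 2**: `Σ_{P,Q} f(P.2 - a) B₂⁽²⁾(P,Q) g(Q.2 - b) ≤ Δ(0) T(f,g)`
(`g` even): summing the entry vertex `u` closes a bubble, giving the weight `g⋆(t - a')`; the rest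
`f – τ – g` is the open triangle. [cite: Hara2008, §3.5 (Case 2, Fig. 5 (d-3))] -/
theorem tsum_line_kB2two_line_false_le (f : Site d → ℝ≥0∞) {g : Site d → ℝ≥0∞} (hg : ∀ v, g (-v) = g v)
    (a b : Site d) :
    ∑' P, ∑' Q, f (P.2 - a) * kB2two d P Q * g (Q.2 - b) ≤ percTri d 0 * tForm d f g := by
  calc ∑' P, ∑' Q, f (P.2 - a) * kB2two d P Q * g (Q.2 - b)
      = ∑' P : Site d × Site d, f (P.2 - a) * ∑' t : Site d, (∑' a' : Site d, tauPcE d (a' - P.2) *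
          tauPcE d (P.1 - a') * tauPcE d (t - a') * tauPcE d (t - P.1)) * g (t - b) := by
        refine tsum_congr fun P => ?_
        have h1 : ∑' Q, f (P.2 - a) * kB2two d P Q * g (Q.2 - b) = f (P.2 - a) * ∑' Q, kB2two d P Q * g (Q.2 - b) := by
          rw [← ENNReal.tsum_mul_left]; exact tsum_congr fun Q => mul_assoc _ _ _
        rw [h1, tsum_kB2two_mul P (fun Q => g (Q.2 - b))]
    -- sum the entry vertex `u = P.1` into a bubble
    _ = ∑' v : Site d, f (v - a) * ∑' t : Site d, (∑' a' : Site d, tauPcE d (a' - v) * gStar d (t - a')) * g (t - b) := by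
        rw [ENNReal.tsum_prod', ENNReal.tsum_comm]
        refine tsum_congr fun v => ?_
        calc ∑' u : Site d, f (v - a) * ∑' t : Site d, (∑' a' : Site d, tauPcE d (a' - v) * tauPcE d (u - a') *
              tauPcE d (t - a') * tauPcE d (t - u)) * g (t - b)
            = ∑' u : Site d, ∑' t : Site d, ∑' a' : Site d, f (v - a) * g (t - b) * (tauPcE d (a' - v) * tauPcE d (t - a')) *
                (tauPcE d (u - a') * tauPcE d (t - u)) := by
              refine tsum_congr fun u => ?_
              rw [← ENNReal.tsum_mul_left]
              refine tsum_congr fun t => ?_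
              rw [← ENNReal.tsum_mul_right, ← ENNReal.tsum_mul_left]
              exact tsum_congr fun a' => by ring
          _ = ∑' t : Site d, ∑' a' : Site d, ∑' u : Site d, f (v - a) * g (t - b) * (tauPcE d (a' - v) * tauPcE d (t - a')) *
                (tauPcE d (u - a') * tauPcE d (t - u)) := by
              rw [ENNReal.tsum_comm]
              exact tsum_congr fun t => ENNReal.tsum_comm
          _ = ∑' t : Site d, ∑' a' : Site d, f (v - a) * g (t - b) * (tauPcE d (a' - v) * gStar d (t - a')) := by
              refine tsum_congr fun t => tsum_congr fun a' => ?_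
              rw [ENNReal.tsum_mul_left, tsum_tau2_eq_percBubble, gStar]
              ring
          _ = f (v - a) * ∑' t : Site d, (∑' a' : Site d, tauPcE d (a' - v) * gStar d (t - a')) * g (t - b) := by
              rw [← ENNReal.tsum_mul_left]
              refine tsum_congr fun t => ?_
              rw [← ENNReal.tsum_mul_right, ← ENNReal.tsum_mul_left]
              exact tsum_congr fun a' => by ring
    -- `t = w + a'`: the weight `g⋆(w)` comes out, the rest is `Σ_{v,a'} f(v-a) τ(a'-v) g(a'+w-b)`
    _ = ∑' v : Site d, f (v - a) * ∑' w : Site d, gStar d w * ∑' a' : Site d, tauPcE d (a' - v) * g (a' + w - b) := by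
        refine tsum_congr fun v => ?_
        congr 1
        calc ∑' t : Site d, (∑' a' : Site d, tauPcE d (a' - v) * gStar d (t - a')) * g (t - b)
            = ∑' a' : Site d, ∑' t : Site d, tauPcE d (a' - v) * gStar d (t - a') * g (t - b) := by
              rw [ENNReal.tsum_comm]
              exact tsum_congr fun t => (ENNReal.tsum_mul_right).symm
          _ = ∑' a' : Site d, ∑' w : Site d, tauPcE d (a' - v) * gStar d w * g (w + a' - b) := by
              refine tsum_congr fun a' => ?_
              rw [tsum_shift _ a']
              exact tsum_congr fun w => by rw [add_sub_cancel_right]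
          _ = ∑' w : Site d, ∑' a' : Site d, tauPcE d (a' - v) * gStar d w * g (w + a' - b) := ENNReal.tsum_comm
          _ = _ := by
              refine tsum_congr fun w => ?_
              rw [← ENNReal.tsum_mul_left]
              exact tsum_congr fun a' => by rw [show w + a' - b = a' + w - b by abel]; ring
    _ = ∑' w : Site d, gStar d w * ∑' v : Site d, ∑' a' : Site d, f (v - a) * tauPcE d (a' - v) * g (a' + w - b) := by
        calc ∑' v : Site d, f (v - a) * ∑' w : Site d, gStar d w * ∑' a' : Site d, tauPcE d (a' - v) * g (a' + w - b)
            = ∑' v : Site d, ∑' w : Site d, gStar d w * ∑' a' : Site d, f (v - a) * tauPcE d (a' - v) * g (a' + w - b) := by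
              refine tsum_congr fun v => ?_
              rw [← ENNReal.tsum_mul_left]
              refine tsum_congr fun w => ?_
              rw [mul_left_comm, ← ENNReal.tsum_mul_left]
              congr 1
              exact tsum_congr fun a' => (mul_assoc _ _ _).symm
          _ = ∑' w : Site d, ∑' v : Site d, gStar d w * ∑' a' : Site d, f (v - a) * tauPcE d (a' - v) * g (a' + w - b) :=
              ENNReal.tsum_comm
          _ = _ := tsum_congr fun w => ENNReal.tsum_mul_left
    _ ≤ ∑' w : Site d, gStar d w * tForm d f g := by
        refine ENNReal.tsum_le_tsum fun w => mul_le_mul' le_rfl ?_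
        calc ∑' v : Site d, ∑' a' : Site d, f (v - a) * tauPcE d (a' - v) * g (a' + w - b)
            = ∑' P : Site d × Site d, f (P.1 - a) * tauPcE d (P.2 - P.1) * g ((b - w) - P.2) := by
              rw [ENNReal.tsum_prod']
              refine tsum_congr fun v => tsum_congr fun a' => ?_
              rw [← hg (a' + w - b), show -(a' + w - b) = b - w - a' by abel]
          _ = ∑' P : Site d × Site d, f P.1 * tauPcE d (P.2 - P.1) * g (b - w - a - P.2) := tsum_series3 _ _ _ a (b - w)
          _ = ∑' P : Site d × Site d, f P.1 * g (P.2 - P.1) * tauPcE d (b - w - a - P.2) := tsum_swap23 f g _ _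
          _ ≤ tForm d f g := tsum_le_tForm f g _
    _ = percTri d 0 * tForm d f g := by rw [ENNReal.tsum_mul_right, tsum_gStar]

/-- The lone star block bounded for either coordinate. [cite: Hara2008, §3.5 (Case 2)] -/
theorem tsum_line_kB2two_line_le (eC : Bool) (f : Site d → ℝ≥0∞) {g : Site d → ℝ≥0∞} (hg : ∀ v, g (-v) = g v)
    (a b : Site d) :
    ∑' P, ∑' Q, f (crd eC P - a) * kB2two d P Q * g (crd eC Q - b) ≤ percTri d 0 * tForm d f g := by
  cases eC
  · exact tsum_line_kB2two_line_false_le f hg a b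
  · exact tsum_line_kB2two_line_true_le f hg a b

/-- A chain is additive in one of its kernels. [folklore] -/
theorem tsum_pkChainL_append_cons_add (v e : Site d × Site d → ℝ≥0∞)
    (L R : List (Site d × Site d → Site d × Site d → ℝ≥0∞)) (K K' : Site d × Site d → Site d × Site d → ℝ≥0∞) :
    ∑' s, pkChainL v (L ++ (fun p q => K p q + K' p q) :: R) s * e s =
      (∑' s, pkChainL v (L ++ K :: R) s * e s) + ∑' s, pkChainL v (L ++ K' :: R) s * e s := by
  rw [← ENNReal.tsum_add]
  refine tsum_congr fun s => ?_
  rw [pkChainL_append, pkChainL_append, pkChainL_append, pkChainL_cons, pkChainL_cons, pkChainL_cons,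
    pkVmul_add_kernel, pkChainL_add]
  simp only [add_mul]

/-- **The lone star block between the two erased lines** (entry and exit on the same coordinate
`e`, no rungs): for the chain `v L X B₂ Y R e` with `X(p,P) ≤ c_F f(P_e - πp)` and
`Y(Q,q) ≤ c_G g(Q_e - π'q)`, the `B₂⁽¹⁾`-part closes under Cauchy–Schwarz (`H1`, `T1`) and the
`B₂⁽²⁾`-part is the closed diagram above:
`Σ chain ≤ ‖vL‖₁ ‖Re‖₁ (A S̄ + c_F c_G Δ(0) T)` whenever `c_F²‖f‖₂², c_G²‖g‖₂² ≤ A`, `T(f,g) ≤ T`.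
[cite: Hara2008, §3.5 (Case 2, Fig. 5 (d-1)–(d-3))] -/
theorem chain_loneB2_le (v e : Site d × Site d → ℝ≥0∞)
    (Lpre Rpost : List (Site d × Site d → Site d × Site d → ℝ≥0∞))
    (X Y : Site d × Site d → Site d × Site d → ℝ≥0∞) (eC : Bool)
    {cF cG : ℝ≥0∞} {f g : Site d → ℝ≥0∞} {πF πG : Site d × Site d → Site d}
    (hX : ∀ p P, X p P ≤ cF * f (crd eC P - πF p) * (fun _ => (1 : ℝ≥0∞)) P)
    (hY : ∀ Q q, Y Q q ≤ (fun _ => (1 : ℝ≥0∞)) Q * (cG * g (crd eC Q - πG q)))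
    (hg : ∀ v, g (-v) = g v)
    {M₁ M₂ A T : ℝ≥0∞} (h₁ : ∑' p, pkChainL v Lpre p ≤ M₁) (h₂ : ∑' q, pkChainR Rpost e q ≤ M₂)
    (hA : cF ^ 2 * ∑' a, f a ^ 2 ≤ A) (hC : cG ^ 2 * ∑' a, g a ^ 2 ≤ A) (hT : tForm d f g ≤ T) :
    ∑' s, pkChainL v (Lpre ++ X :: kB2 d :: Y :: Rpost) s * e s ≤
      M₁ * M₂ * (A * percSqBar d + cF * cG * percTri d 0 * T) := by
  have hsplit : ∑' s, pkChainL v (Lpre ++ X :: kB2 d :: Y :: Rpost) s * e s =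
      (∑' s, pkChainL v (Lpre ++ X :: kB2one d :: Y :: Rpost) s * e s) +
        ∑' s, pkChainL v (Lpre ++ X :: kB2two d :: Y :: Rpost) s * e s := by
    have h := tsum_pkChainL_append_cons_add v e (Lpre ++ [X]) (Y :: Rpost) (kB2one d) (kB2two d)
    simp only [List.append_assoc, List.singleton_append] at h
    rw [kB2_eq_add]
    exact h
  rw [hsplit]
  have hone : ∀ q : Site d × Site d, (fun _ : Site d × Site d => (1 : ℝ≥0∞)) q ≤ 1 := fun _ => le_rfl
  -- the `B₂⁽¹⁾` part: Cauchy–Schwarz with the middle factor `B₂⁽¹⁾` alone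
  have h1 : ∑' s, pkChainL v (Lpre ++ X :: kB2one d :: Y :: Rpost) s * e s ≤ M₁ * M₂ * (A * percSqBar d) := by
    have hH : pkHeadB eC (midU (fun _ => (1 : ℝ≥0∞)) [kB2one d] (fun _ => 1)) ≤ percSqBar d := by
      refine (pkHeadB_midU_kB2one_le eC hone [] _).trans ?_
      calc percSqBar d * pkNormInf (pkScaleR (pkProdI []) fun _ => (1 : ℝ≥0∞))
          ≤ percSqBar d * 1 := mul_le_mul' le_rfl
            ((pkNormInf_pkScaleR_le_of_le_one hone _).trans (by simpa using pkNormInf_kId_le))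
        _ = percSqBar d := mul_one _
    have hT' : pkTailB eC (midU (fun _ => (1 : ℝ≥0∞)) [kB2one d] (fun _ => 1)) ≤ percSqBar d := by
      have h := pkTailB_midU_snoc_kB2one_le eC (fun _ => (1 : ℝ≥0∞)) [] hone
      rw [List.nil_append] at h
      refine h.trans ?_
      calc pkNormOne (pkScaleL (fun _ => (1 : ℝ≥0∞)) (pkProdI [])) * percSqBar d
          ≤ 1 * percSqBar d := mul_le_mul'
            ((pkNormOne_pkScaleL_le_of_le_one hone _).trans (by simpa using pkNormOne_kId_le)) le_rfl
        _ = percSqBar d := one_mul _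
    exact chain_cs_le v e Lpre [kB2one d] Rpost X Y eC eC hX hY h₁ hA hH hT' hC h₂ (le_of_eq (by ring))
  -- the `B₂⁽²⁾` part: the closed diagram, pointwise
  have h2 : ∑' s, pkChainL v (Lpre ++ X :: kB2two d :: Y :: Rpost) s * e s ≤
      M₁ * (cF * cG * percTri d 0 * T) * M₂ := by
    rw [pkChainL_append_cons_cons v Lpre X (kB2two d) (Y :: Rpost), pkChainL_append_cons_cons v Lpre _ Y Rpost]
    refine chain_sup_le v e Lpre Rpost _ (fun p q => ?_) h₁ h₂
    calc pkMul (pkMul X (kB2two d)) Y p q = ∑' Q, (∑' P, X p P * kB2two d P Q) * Y Q q := rfl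
      _ = ∑' Q, ∑' P, X p P * kB2two d P Q * Y Q q := tsum_congr fun Q => ENNReal.tsum_mul_right.symm
      _ = ∑' P, ∑' Q, X p P * kB2two d P Q * Y Q q := ENNReal.tsum_comm
      _ ≤ ∑' P, ∑' Q, (cF * f (crd eC P - πF p)) * kB2two d P Q * (cG * g (crd eC Q - πG q)) :=
          ENNReal.tsum_le_tsum fun P => ENNReal.tsum_le_tsum fun Q =>
            mul_le_mul' (mul_le_mul' (by simpa using hX p P) le_rfl) (by simpa using hY Q q)
      _ = cF * cG * ∑' P, ∑' Q, f (crd eC P - πF p) * kB2two d P Q * g (crd eC Q - πG q) := by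
          rw [← ENNReal.tsum_mul_left]
          refine tsum_congr fun P => ?_
          rw [← ENNReal.tsum_mul_left]
          exact tsum_congr fun Q => by ring
      _ ≤ cF * cG * (percTri d 0 * T) :=
          mul_le_mul' le_rfl ((tsum_line_kB2two_line_le eC f hg _ _).trans (mul_le_mul' le_rfl hT))
      _ = cF * cG * percTri d 0 * T := by ring
  calc (∑' s, pkChainL v (Lpre ++ X :: kB2one d :: Y :: Rpost) s * e s) +
        ∑' s, pkChainL v (Lpre ++ X :: kB2two d :: Y :: Rpost) s * e s
      ≤ M₁ * M₂ * (A * percSqBar d) + M₁ * (cF * cG * percTri d 0 * T) * M₂ := add_le_add h1 h2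
    _ = M₁ * M₂ * (A * percSqBar d + cF * cG * percTri d 0 * T) := by ring

/-! ### The three overlaps of the star block with an erased neighbour -/

/-- `Σ_v Δ(v - a) τ(b - v) = S(b - a)`. [cite: Hara2008, §1.1] -/
theorem tsum_percTri_mul_tau (a b : Site d) :
    ∑' v : Site d, percTri d (v - a) * tauPcE d (b - v) = percSq d (b - a) := by
  rw [percSq_eq_tsum_tau_mul_percTri, tsum_reflect_shift _ b]
  refine tsum_congr fun u => ?_
  rw [show b - (b - u) = u by abel, show b - u - a = b - a - u by abel, mul_comm]

/-- `Δ̃(x) = Σ_z (τ⋆τ)(z) τ̃(x - z)`. [cite: HeydenreichVanDerHofstad2017, (7.2.2)] -/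
theorem percTriTilde_eq_tsum_percBubble_mul (x : Site d) :
    percTriTilde d x = ∑' z : Site d, percBubble d z * tauTildePcE d (x - z) := by
  calc percTriTilde d x = ∑' y : Site d, ∑' z : Site d, tauPcE d y * tauPcE d (z - y) * tauTildePcE d (x - z) := by
        rw [percTriTilde, ENNReal.tsum_prod']
    _ = ∑' z : Site d, ∑' y : Site d, tauPcE d y * tauPcE d (z - y) * tauTildePcE d (x - z) := ENNReal.tsum_comm
    _ = _ := by
        refine tsum_congr fun z => ?_
        rw [percBubble, ← ENNReal.tsum_mul_right]

/-- `Σ_w bbT(w - a) τ(c - w) = Δ̃(c - a) ≤ Δ̃` (`τ̃⋆τ⋆τ`). [cite: HeydenreichVanDerHofstad2017, (7.2.2)] -/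
theorem tsum_bbT_mul_tau_le (a c : Site d) : ∑' w : Site d, bbT d (w - a) * tauPcE d (c - w) ≤ percTriTildeBar d := by
  have h : ∑' w : Site d, bbT d (w - a) * tauPcE d (c - w) = percTriTilde d (c - a) := by
    calc ∑' w : Site d, bbT d (w - a) * tauPcE d (c - w)
        = ∑' w : Site d, ∑' t : Site d, tauTildePcE d t * (tauPcE d (w - a - t) * tauPcE d (c - w)) := by
          refine tsum_congr fun w => ?_
          rw [bbT, ← ENNReal.tsum_mul_right]
          exact tsum_congr fun t => mul_assoc _ _ _
      _ = ∑' t : Site d, tauTildePcE d t * ∑' w : Site d, tauPcE d (w - (a + t)) * tauPcE d (c - w) := by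
          rw [ENNReal.tsum_comm]
          refine tsum_congr fun t => ?_
          rw [← ENNReal.tsum_mul_left]
          exact tsum_congr fun w => by rw [show w - a - t = w - (a + t) by abel]
      _ = ∑' t : Site d, percBubble d (c - a - t) * tauTildePcE d t := by
          refine tsum_congr fun t => ?_
          rw [tsum_tau2_eq_percBubble, show c - (a + t) = c - a - t by abel, mul_comm]
      _ = ∑' z : Site d, percBubble d z * tauTildePcE d (c - a - z) := by
          rw [tsum_reflect_shift _ (c - a)]
          exact tsum_congr fun z => by rw [show c - a - (c - a - z) = z by abel]
      _ = percTriTilde d (c - a) := (percTriTilde_eq_tsum_percBubble_mul _).symm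
  rw [h]
  exact le_iSup (percTriTilde d) _

/-- **`Σ_P B₁(p, P) (τ⋆τ)(P.2 - P.1) ≤ 2d S̄`** (the two lines of `B₁` closed by a bubble: a square
with one pivotal line). [cite: Hara2008, §3.5 (Case 2: "a square S̄^{(0)}")] -/
theorem tsum_kB1_mul_percBubble_le (p : Site d × Site d) :
    ∑' P, kB1 d p P * percBubble d (P.2 - P.1) ≤ 2 * d * percSqBar d := by
  calc ∑' P, kB1 d p P * percBubble d (P.2 - P.1)
      = ∑' t : Site d, tauTildePcE d (t - p.2) * ∑' z : Site d, tauPcE d (z - p.1) * percBubble d (t - z) := by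
        rw [ENNReal.tsum_prod', ENNReal.tsum_comm]
        refine tsum_congr fun t => ?_
        rw [← ENNReal.tsum_mul_left]
        refine tsum_congr fun z => ?_
        rw [kB1_eq_kProp, kProp]
        ring
    _ = ∑' t : Site d, tauTildePcE d (t - p.2) * percTri d (t - p.1) :=
        tsum_congr fun t => by rw [tsum_tau_mul_percBubble_eq_percTri]
    _ ≤ ∑' t : Site d, 2 * d * (percTri d (t - p.1) * tauPcE d (p.2 - t)) := by
        refine ENNReal.tsum_le_tsum fun t => ?_
        calc tauTildePcE d (t - p.2) * percTri d (t - p.1) ≤ 2 * d * tauPcE d (t - p.2) * percTri d (t - p.1) :=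
              mul_le_mul' (tauTildePcE_le _) le_rfl
          _ = 2 * d * (percTri d (t - p.1) * tauPcE d (p.2 - t)) := by rw [tauPcE_sub_comm t p.2]; ring
    _ = 2 * d * percSq d (p.2 - p.1) := by rw [ENNReal.tsum_mul_left, tsum_percTri_mul_tau]
    _ ≤ 2 * d * percSqBar d := mul_le_mul' le_rfl (percSq_le_percSqBar _)

/-- **Overlap A — `B₁` with its second line erased, then the erased star, then `B₁`**:
`(P_{τ,1} · S · B₁)(p,q) ≤ Δ̃ S̄` (the star leg to the loose end costs `bbT ≤ Δ̃`; the remaining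
lines `τ, τ⋆τ, Δ, τ` between `p.1` and `q.1` form a square). [cite: Hara2008, §3.5 (Case 2, Fig. 5 (d-3))] -/
theorem conflictA_le (p q : Site d × Site d) :
    pkMul (kProp (tauPcE d) (oneF d)) (pkMul (kB2twoEr d) (kB1 d)) p q ≤ percTriTildeBar d * percSqBar d := by
  calc pkMul (kProp (tauPcE d) (oneF d)) (pkMul (kB2twoEr d) (kB1 d)) p q
      = ∑' P : Site d × Site d, tauPcE d (P.1 - p.1) * (tauPcE d (q.1 - P.2) *
          ∑' a : Site d, tauPcE d (a - P.1) * tauPcE d (P.2 - a) * bbT d (q.2 - a)) := by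
        refine tsum_congr fun P => ?_
        rw [pkMul, tsum_kB2twoEr_mul_kB1, kProp, oneF_apply, mul_one]
    _ ≤ ∑' P : Site d × Site d, tauPcE d (P.1 - p.1) * (tauPcE d (q.1 - P.2) *
          ∑' a : Site d, tauPcE d (a - P.1) * tauPcE d (P.2 - a) * percTriTildeBar d) := by
        refine ENNReal.tsum_le_tsum fun P => ?_
        refine mul_le_mul' le_rfl (mul_le_mul' le_rfl ?_)
        exact ENNReal.tsum_le_tsum fun a => mul_le_mul' le_rfl (bbT_le_percTriTildeBar _)
    _ = percTriTildeBar d * ∑' P : Site d × Site d,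
          tauPcE d (P.1 - p.1) * percBubble d (P.2 - P.1) * tauPcE d (q.1 - P.2) := by
        rw [← ENNReal.tsum_mul_left]
        refine tsum_congr fun P => ?_
        rw [ENNReal.tsum_mul_right, tsum_tau2_eq_percBubble]
        ring
    _ = percTriTildeBar d * ∑' v : Site d, percTri d (v - p.1) * tauPcE d (q.1 - v) := by
        congr 1
        rw [ENNReal.tsum_prod', ENNReal.tsum_comm]
        refine tsum_congr fun v => ?_
        rw [← tsum_tau_mul_percBubble_eq_percTri p.1 v, ← ENNReal.tsum_mul_right]
    _ = percTriTildeBar d * percSq d (q.1 - p.1) := by rw [tsum_percTri_mul_tau]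
    _ ≤ percTriTildeBar d * percSqBar d := mul_le_mul' le_rfl (percSq_le_percSqBar _)

/-- The erased star followed by `B₁` with its first line erased: `Σ_Q S(P,Q) τ̃(q.2 - Q.2) = Σ_a τ(a-P.1) τ(P.2-a) bbT(q.2-a)`.
[cite: HeydenreichVanDerHofstad2017, (7.4.4)] -/
theorem tsum_kB2twoEr_mul_oneTilde (P q : Site d × Site d) :
    ∑' Q, kB2twoEr d P Q * kProp (oneF d) (tauTildePcE d) Q q =
      ∑' a : Site d, tauPcE d (a - P.1) * tauPcE d (P.2 - a) * bbT d (q.2 - a) := by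
  rw [ENNReal.tsum_prod', tsum_eq_single P.2]
  · simp only [kB2twoEr, if_true, kProp, oneF_apply, one_mul]
    calc ∑' w : Site d, (∑' a : Site d, tauPcE d (a - P.1) * tauPcE d (P.2 - a) * tauPcE d (w - a)) *
          tauTildePcE d (q.2 - w)
        = ∑' w : Site d, ∑' a : Site d, tauPcE d (a - P.1) * tauPcE d (P.2 - a) * (tauPcE d (w - a) * tauTildePcE d (q.2 - w)) := by
          refine tsum_congr fun w => ?_
          rw [← ENNReal.tsum_mul_right]
          exact tsum_congr fun a => by ring
      _ = ∑' a : Site d, ∑' w : Site d, tauPcE d (a - P.1) * tauPcE d (P.2 - a) * (tauPcE d (w - a) * tauTildePcE d (q.2 - w)) :=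
          ENNReal.tsum_comm
      _ = _ := by
          refine tsum_congr fun a => ?_
          rw [ENNReal.tsum_mul_left, tsum_tau_tauTilde_eq_bbT]
  · intro w hw
    simp [kB2twoEr, Ne.symm hw]

/-- **Overlap B — `B₁`, the erased star, then `B₁` with its first line erased**:
`(B₁ · S · P_{1,τ̃})(p,q) ≤ 2d Δ̃ S̄`. [cite: Hara2008, §3.5 (Case 2, Fig. 5 (d-3))] -/
theorem conflictB_le (p q : Site d × Site d) :
    pkMul (kB1 d) (pkMul (kB2twoEr d) (kProp (oneF d) (tauTildePcE d))) p q ≤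
      2 * d * (percTriTildeBar d * percSqBar d) := by
  calc pkMul (kB1 d) (pkMul (kB2twoEr d) (kProp (oneF d) (tauTildePcE d))) p q
      = ∑' P, kB1 d p P * ∑' a : Site d, tauPcE d (a - P.1) * tauPcE d (P.2 - a) * bbT d (q.2 - a) := by
        refine tsum_congr fun P => ?_
        rw [pkMul, tsum_kB2twoEr_mul_oneTilde]
    _ ≤ ∑' P, kB1 d p P * ∑' a : Site d, tauPcE d (a - P.1) * tauPcE d (P.2 - a) * percTriTildeBar d :=
        ENNReal.tsum_le_tsum fun P => mul_le_mul' le_rfl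
          (ENNReal.tsum_le_tsum fun a => mul_le_mul' le_rfl (bbT_le_percTriTildeBar _))
    _ = percTriTildeBar d * ∑' P, kB1 d p P * percBubble d (P.2 - P.1) := by
        rw [← ENNReal.tsum_mul_left]
        refine tsum_congr fun P => ?_
        rw [ENNReal.tsum_mul_right, tsum_tau2_eq_percBubble]
        ring
    _ ≤ percTriTildeBar d * (2 * d * percSqBar d) := mul_le_mul' le_rfl (tsum_kB1_mul_percBubble_le p)
    _ = 2 * d * (percTriTildeBar d * percSqBar d) := by ring

/-- The tail of overlap C for a fixed pair `m`: the first coordinate of the cut pair closes a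
triangle, its second coordinate meets the leg of the second star (`bbT ⋆ τ ≤ Δ̃`), and the legs
of the first star close a bubble. [cite: Hara2008, §3.5 (Case 2, Fig. 5 (d-3))] -/
theorem conflictC_tail_le (m q : Site d × Site d) :
    ∑' P' : Site d × Site d, (tauPcE d (P'.1 - m.2) *
      ∑' a : Site d, tauPcE d (a - m.1) * tauPcE d (m.2 - a) * bbT d (P'.2 - a)) *
        (tauPcE d (q.1 - P'.2) * percBubble d (P'.2 - P'.1)) ≤
      percTriBar d * percTriTildeBar d * percBubble d (m.2 - m.1) := by
  calc ∑' P' : Site d × Site d, (tauPcE d (P'.1 - m.2) *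
        ∑' a : Site d, tauPcE d (a - m.1) * tauPcE d (m.2 - a) * bbT d (P'.2 - a)) *
          (tauPcE d (q.1 - P'.2) * percBubble d (P'.2 - P'.1))
      = ∑' w : Site d, (∑' a : Site d, tauPcE d (a - m.1) * tauPcE d (m.2 - a) * bbT d (w - a)) *
          tauPcE d (q.1 - w) * ∑' z : Site d, tauPcE d (z - m.2) * percBubble d (w - z) := by
        rw [ENNReal.tsum_prod', ENNReal.tsum_comm]
        refine tsum_congr fun w => ?_
        rw [← ENNReal.tsum_mul_left]
        refine tsum_congr fun z => ?_
        dsimp only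
        ring
    _ ≤ ∑' w : Site d, (∑' a : Site d, tauPcE d (a - m.1) * tauPcE d (m.2 - a) * bbT d (w - a)) *
          tauPcE d (q.1 - w) * percTriBar d := by
        refine ENNReal.tsum_le_tsum fun w => mul_le_mul' le_rfl ?_
        rw [tsum_tau_mul_percBubble_eq_percTri]
        exact le_iSup (percTri d) _
    _ = percTriBar d * ∑' a : Site d, tauPcE d (a - m.1) * tauPcE d (m.2 - a) *
          ∑' w : Site d, bbT d (w - a) * tauPcE d (q.1 - w) := by
        rw [ENNReal.tsum_mul_right, mul_comm]
        congr 1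
        calc ∑' w : Site d, (∑' a : Site d, tauPcE d (a - m.1) * tauPcE d (m.2 - a) * bbT d (w - a)) * tauPcE d (q.1 - w)
            = ∑' w : Site d, ∑' a : Site d, tauPcE d (a - m.1) * tauPcE d (m.2 - a) * (bbT d (w - a) * tauPcE d (q.1 - w)) := by
              refine tsum_congr fun w => ?_
              rw [← ENNReal.tsum_mul_right]
              exact tsum_congr fun a => by ring
          _ = ∑' a : Site d, ∑' w : Site d, tauPcE d (a - m.1) * tauPcE d (m.2 - a) * (bbT d (w - a) * tauPcE d (q.1 - w)) :=
              ENNReal.tsum_comm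
          _ = _ := tsum_congr fun a => ENNReal.tsum_mul_left
    _ ≤ percTriBar d * ∑' a : Site d, tauPcE d (a - m.1) * tauPcE d (m.2 - a) * percTriTildeBar d := by
        refine mul_le_mul' le_rfl (ENNReal.tsum_le_tsum fun a => ?_)
        exact mul_le_mul' le_rfl (tsum_bbT_mul_tau_le _ _)
    _ = percTriBar d * percTriTildeBar d * percBubble d (m.2 - m.1) := by
        rw [ENNReal.tsum_mul_right, tsum_tau2_eq_percBubble]; ring

/-- Reorganising the first star between its two `B₁` against a weight on the cut pair:
`Σ_{P'} (B₁ S B₁)(p, P') W(P') = Σ_m B₁(p, m) Σ_{P'} [τ(P'.1 - m.2) Σ_a τ(a - m.1) τ(m.2 - a) bbT(P'.2 - a)] W(P')`.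
[cite: HeydenreichVanDerHofstad2017, (7.4.4)] -/
theorem tsum_pkMul_kB1_star_mul (p : Site d × Site d) (W : Site d × Site d → ℝ≥0∞) :
    ∑' P', pkMul (kB1 d) (pkMul (kB2twoEr d) (kB1 d)) p P' * W P' =
      ∑' m, kB1 d p m * ∑' P' : Site d × Site d, (tauPcE d (P'.1 - m.2) *
        ∑' a : Site d, tauPcE d (a - m.1) * tauPcE d (m.2 - a) * bbT d (P'.2 - a)) * W P' := by
  have h1 : ∀ P' : Site d × Site d, pkMul (kB1 d) (pkMul (kB2twoEr d) (kB1 d)) p P' * W P' =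
      ∑' m, kB1 d p m * ((tauPcE d (P'.1 - m.2) *
        ∑' a : Site d, tauPcE d (a - m.1) * tauPcE d (m.2 - a) * bbT d (P'.2 - a)) * W P') := by
    intro P'
    rw [pkMul, ← ENNReal.tsum_mul_right]
    refine tsum_congr fun m => ?_
    rw [pkMul, tsum_kB2twoEr_mul_kB1, mul_assoc]
  calc ∑' P', pkMul (kB1 d) (pkMul (kB2twoEr d) (kB1 d)) p P' * W P'
      = ∑' P' : Site d × Site d, ∑' m : Site d × Site d, kB1 d p m * ((tauPcE d (P'.1 - m.2) *
          ∑' a : Site d, tauPcE d (a - m.1) * tauPcE d (m.2 - a) * bbT d (P'.2 - a)) * W P') := tsum_congr h1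
    _ = ∑' m : Site d × Site d, ∑' P' : Site d × Site d, kB1 d p m * ((tauPcE d (P'.1 - m.2) *
          ∑' a : Site d, tauPcE d (a - m.1) * tauPcE d (m.2 - a) * bbT d (P'.2 - a)) * W P') := ENNReal.tsum_comm
    _ = _ := tsum_congr fun m => ENNReal.tsum_mul_left

/-- **Overlap C — two erased stars sharing the `B₁` between them**: `(B₁ S B₁ S B₁)(p,q) ≤ 2d Δ̃² Δ̄ S̄`
(sum the degree-two vertex of the second star into `bbT ≤ Δ̃` — NOT into the five-line chain, which
needs `d > 10` —, then a triangle `≤ Δ̄`, the leg into the loose end `≤ Δ̃`, and the square of Overlap B).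
[cite: Hara2008, §3.5 (Case 2, Fig. 5 (d-3))] -/
theorem conflictC_le (p q : Site d × Site d) :
    pkMul (pkMul (kB1 d) (pkMul (kB2twoEr d) (kB1 d))) (pkMul (kB2twoEr d) (kB1 d)) p q ≤
      2 * d * (percTriTildeBar d ^ 2 * percTriBar d * percSqBar d) := by
  -- the second star followed by `B₁`: `(S B₁)(P', q) ≤ Δ̃ τ(q.1 - P'.2) (τ⋆τ)(P'.2 - P'.1)`
  have hSB : ∀ P' : Site d × Site d, pkMul (kB2twoEr d) (kB1 d) P' q ≤
      percTriTildeBar d * (tauPcE d (q.1 - P'.2) * percBubble d (P'.2 - P'.1)) := by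
    intro P'
    rw [pkMul, tsum_kB2twoEr_mul_kB1]
    calc tauPcE d (q.1 - P'.2) * ∑' a : Site d, tauPcE d (a - P'.1) * tauPcE d (P'.2 - a) * bbT d (q.2 - a)
        ≤ tauPcE d (q.1 - P'.2) * ∑' a : Site d, tauPcE d (a - P'.1) * tauPcE d (P'.2 - a) * percTriTildeBar d := by
          refine mul_le_mul' le_rfl (ENNReal.tsum_le_tsum fun a => ?_)
          exact mul_le_mul' le_rfl (bbT_le_percTriTildeBar _)
      _ = percTriTildeBar d * (tauPcE d (q.1 - P'.2) * percBubble d (P'.2 - P'.1)) := by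
          rw [ENNReal.tsum_mul_right, tsum_tau2_eq_percBubble]; ring
  have hstep : ∀ P' : Site d × Site d,
      pkMul (kB1 d) (pkMul (kB2twoEr d) (kB1 d)) p P' * pkMul (kB2twoEr d) (kB1 d) P' q ≤
        percTriTildeBar d * (pkMul (kB1 d) (pkMul (kB2twoEr d) (kB1 d)) p P' *
          (tauPcE d (q.1 - P'.2) * percBubble d (P'.2 - P'.1))) := by
    intro P'
    calc pkMul (kB1 d) (pkMul (kB2twoEr d) (kB1 d)) p P' * pkMul (kB2twoEr d) (kB1 d) P' q
        ≤ pkMul (kB1 d) (pkMul (kB2twoEr d) (kB1 d)) p P' *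
            (percTriTildeBar d * (tauPcE d (q.1 - P'.2) * percBubble d (P'.2 - P'.1))) := mul_le_mul' le_rfl (hSB P')
      _ = _ := mul_left_comm _ _ _
  calc pkMul (pkMul (kB1 d) (pkMul (kB2twoEr d) (kB1 d))) (pkMul (kB2twoEr d) (kB1 d)) p q
      = ∑' P', pkMul (kB1 d) (pkMul (kB2twoEr d) (kB1 d)) p P' * pkMul (kB2twoEr d) (kB1 d) P' q := rfl
    _ ≤ ∑' P', percTriTildeBar d * (pkMul (kB1 d) (pkMul (kB2twoEr d) (kB1 d)) p P' *
          (tauPcE d (q.1 - P'.2) * percBubble d (P'.2 - P'.1))) := ENNReal.tsum_le_tsum hstep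
    _ = percTriTildeBar d * ∑' m, kB1 d p m * ∑' P' : Site d × Site d, (tauPcE d (P'.1 - m.2) *
          ∑' a : Site d, tauPcE d (a - m.1) * tauPcE d (m.2 - a) * bbT d (P'.2 - a)) *
            (tauPcE d (q.1 - P'.2) * percBubble d (P'.2 - P'.1)) := by
        rw [ENNReal.tsum_mul_left, tsum_pkMul_kB1_star_mul]
    _ ≤ percTriTildeBar d * ∑' m, (percTriBar d * percTriTildeBar d) * (kB1 d p m * percBubble d (m.2 - m.1)) := by
        refine mul_le_mul' le_rfl (ENNReal.tsum_le_tsum fun m => ?_)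
        exact (mul_le_mul' le_rfl (conflictC_tail_le m q)).trans_eq (mul_left_comm _ _ _)
    _ = percTriTildeBar d * ((percTriBar d * percTriTildeBar d) * ∑' m, kB1 d p m * percBubble d (m.2 - m.1)) := by
        rw [ENNReal.tsum_mul_left]
    _ ≤ percTriTildeBar d * ((percTriBar d * percTriTildeBar d) * (2 * d * percSqBar d)) :=
        mul_le_mul' le_rfl (mul_le_mul' le_rfl (tsum_kB1_mul_percBubble_le p))
    _ = 2 * d * (percTriTildeBar d ^ 2 * percTriBar d * percSqBar d) := by ring

/-! ### Moving the start and end vectors into the chain; rungs and scalars -/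

/-- A chain from the row `X((0,0), ·)` of a kernel is the chain from the point mass through `X`. [folklore] -/
theorem pkChainL_row_eq_vDelta (X : Site d × Site d → Site d × Site d → ℝ≥0∞)
    (R : List (Site d × Site d → Site d × Site d → ℝ≥0∞)) :
    pkChainL (fun q => X (0, 0) q) R = pkChainL (vDelta d) (X :: R) := by
  rw [pkChainL_cons]
  congr 1
  funext q
  exact (pkVmul_vDelta X q).symm

/-- `Σ_p δ_{(0,0)}(p) ≤ 1` (in fact `= 1`). [folklore] -/
theorem tsum_vDelta_le : ∑' p : Site d × Site d, pkChainL (vDelta d) [] p ≤ 1 := by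
  rw [pkChainL_nil, tsum_vDelta]

/-- Closing a chain by the column `K(·, q₀)` of a kernel is evaluating the longer chain at `q₀`,
i.e. closing it by the point mass at `q₀`. [folklore] -/
theorem tsum_pkChainL_mul_col_eq (w : Site d × Site d → ℝ≥0∞) (L : List (Site d × Site d → Site d × Site d → ℝ≥0∞))
    (K : Site d × Site d → Site d × Site d → ℝ≥0∞) (q₀ : Site d × Site d) :
    ∑' Q, pkChainL w L Q * K Q q₀ =
      ∑' Q, pkChainL w (L ++ [K]) Q * (if Q = q₀ then (1 : ℝ≥0∞) else 0) := by
  symm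
  rw [tsum_eq_single q₀]
  · rw [if_pos rfl, mul_one, pkChainL_append, pkChainL_cons, pkChainL_nil, pkVmul]
  · intro Q hQ
    rw [if_neg hQ, mul_zero]

/-- The point mass as an end vector has mass `1`. [folklore] -/
theorem tsum_pkChainR_nil_point (q₀ : Site d × Site d) :
    ∑' q, pkChainR [] (fun q => if q = q₀ then (1 : ℝ≥0∞) else 0) q ≤ 1 := by
  rw [pkChainR_nil, tsum_ite_pair_eq_one]

/-- A rung on the start of a right chain sits on its first kernel. [folklore] -/
theorem tsum_rho_mul_pkChainR_cons (K : Site d × Site d → Site d × Site d → ℝ≥0∞)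
    (R : List (Site d × Site d → Site d × Site d → ℝ≥0∞)) (f : Site d × Site d → ℝ≥0∞) :
    ∑' P, rho d P * pkChainR (K :: R) f P = ∑' P, pkChainR (pkScaleL (rho d) K :: R) f P := by
  refine tsum_congr fun P => ?_
  rw [pkChainR_cons, pkChainR_cons, pkKvec, pkKvec, ← ENNReal.tsum_mul_left]
  exact tsum_congr fun Q => by rw [pkScaleL_apply, mul_assoc]

/-- A weight on the end of a left chain sits on its last kernel. [folklore] -/
theorem tsum_pkChainL_snoc_mul (v : Site d × Site d → ℝ≥0∞) (L : List (Site d × Site d → Site d × Site d → ℝ≥0∞))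
    (K : Site d × Site d → Site d × Site d → ℝ≥0∞) (r : Site d × Site d → ℝ≥0∞) :
    ∑' Q, pkChainL v (L ++ [K]) Q * r Q = ∑' Q, pkChainL v (L ++ [pkScaleR K r]) Q := by
  refine tsum_congr fun Q => ?_
  rw [pkChainL_append, pkChainL_append, pkChainL_cons, pkChainL_cons, pkChainL_nil, pkChainL_nil, pkVmul, pkVmul,
    ← ENNReal.tsum_mul_right]
  exact tsum_congr fun P => by rw [pkScaleR_apply, mul_assoc]

/-- A scalar on the start vector comes out of the closed chain. [folklore] -/
theorem tsum_pkChainL_const_mul_start (c : ℝ≥0∞) (v : Site d × Site d → ℝ≥0∞)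
    (L : List (Site d × Site d → Site d × Site d → ℝ≥0∞)) (e : Site d × Site d → ℝ≥0∞) :
    ∑' q, pkChainL (fun p => c * v p) L q * e q = c * ∑' q, pkChainL v L q * e q := by
  rw [pkChainL_smul_start, ← ENNReal.tsum_mul_left]
  exact tsum_congr fun q => (mul_assoc _ _ _)

/-- A scalar on one kernel comes out of the closed chain. [folklore] -/
theorem tsum_pkChainL_const_mul_kernel (v : Site d × Site d → ℝ≥0∞)
    (L R : List (Site d × Site d → Site d × Site d → ℝ≥0∞)) (c : ℝ≥0∞)
    (K : Site d × Site d → Site d × Site d → ℝ≥0∞) (e : Site d × Site d → ℝ≥0∞) :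
    ∑' q, pkChainL v (L ++ (fun p q => c * K p q) :: R) q * e q = c * ∑' q, pkChainL v (L ++ K :: R) q * e q := by
  rw [← ENNReal.tsum_mul_left]
  exact tsum_congr fun q => by rw [pkChainL_append_cons_const_mul, mul_assoc]

/-- **Mass of the right chain opened by a rung**, general end vector: `Σ_q (ρB₁ (B₂B₁)^i f)(q) ≤ Δ̃ κ^i Σ f`.
[cite: HeydenreichVanDerHofstad2017, Exercise 7.5] -/
theorem tsum_pkChainR_rho_altL_le (i : ℕ) (f : Site d × Site d → ℝ≥0∞) :
    ∑' q, pkChainR (pkScaleL (rho d) (kB1 d) :: altL d false (2 * i)) f q ≤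
      percTriTildeBar d * kap d ^ i * ∑' q, f q := by
  rw [pkChainR_eq_pkKvec_pkProdI]
  calc ∑' q, pkKvec (pkProdI (pkScaleL (rho d) (kB1 d) :: altL d false (2 * i))) f q
      ≤ pkNormOne (pkProdI (pkScaleL (rho d) (kB1 d) :: altL d false (2 * i))) * ∑' q, f q := tsum_pkKvec_le _ _
    _ ≤ percTriTildeBar d * kap d ^ i * ∑' q, f q := by
        rw [pkProdI_cons]
        exact mul_le_mul' ((pkNormOne_pkMul_le _ _).trans
          (mul_le_mul' pkNormOne_rho_kB1_le (pkNormOne_altL_false_even_le i))) le_rfl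

end Literature.Barriers.CriticalPhenomena
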